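import Literature.NumberTheory.EllipticCurves.EllCurveTorsionLevelStructure
import Mathlib.LinearAlgebra.Matrix.NonsingularInverse
import HarnessLib

/-!
# `GL₂(ℤ/N)` acts simply transitively on full level-`N` structures (geometric fibres)

Topic: `Literature/NumberTheory/EllipticCurves`. `KugaSatoLevelTwist.lean` constructs the twist
`φ.twistGL γ` of a full level-`N` structure `φ = (P, Q)` by `γ ∈ GL₂(ℤ/N) = (M₂(ℤ/N))ˣ`
(Deligne (3.7): "le groupe `GL₂(ℤ/n)` agit sur `M_n` par `α ↦ α ∘ g`"). This file proves that the
action is SIMPLY TRANSITIVE on geometric fibres: two level-`N` structures `φ, ψ` on the same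
elliptic curve differ, on the fibre over any geometric point `s : Spec Ω → S`, by a unique
`γ ∈ GL₂(ℤ/N)` — both restrict to bases `(ℤ/N)² ≃ E[N](s)` (`EllCurveTorsionLevelStructure`),
and two bases of a free `ℤ/N`-module of rank `2` differ by a unique invertible matrix:

* `LevelStructure.transMat φ ψ s ∈ M₂(ℤ/N)` — the transition matrix (columns: the coordinates of
  `ψ.P|_s`, `ψ.Q|_s` in the basis `φ|_s`), with `restrict_section_eq :
  ψ(x, y)|_s = φ(γ · (x, y)ᵀ)|_s`; it is invertible (`isUnit_transMat`, through
  `Matrix.mulVec_surjective_iff_isUnit`), whence `transGL φ ψ s ∈ GL₂(ℤ/N)`;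
* **`existsUnique_twistGL_restrict`** — `∃! γ ∈ GL₂(ℤ/N)` with `(φ ∘ γ)(x, y)|_s = ψ(x, y)|_s`
  for all `(x, y)`;
* **`existsUnique_twistGL_eq`** — over an algebraically closed field (`S = Spec Ω`) the level
  structures themselves satisfy `ψ = φ.twistGL γ` for a unique `γ`: the set of full level-`N`
  structures on `E/Ω` is a `GL₂(ℤ/N)`-torsor (the fibres of Deligne's `M_n → M_1`, (3.7)).

Hypothesis `[IsCommMonObj C.E]` (so that `P`, `Q` commute, as `twistGL` requires). All proved;
no named facts.

## References

* P. Deligne, *Formes modulaires et représentations ℓ-adiques*, Sém. Bourbaki 355 (1969), (3.7).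
  [Deligne1971Bourbaki355]
* N. Katz, B. Mazur, *Arithmetic moduli of elliptic curves* (1985), (3.1). [KatzMazur1985]
-/

universe u

open CategoryTheory Limits AlgebraicGeometry MonoidalCategory CartesianMonoidalCategory
open scoped MonObj

noncomputable section

namespace Literature.NumberTheory.EllipticCurves

namespace EllCurveOver.LevelStructure

variable {S : Scheme.{u}} {C : EllCurveOver S} {N : ℕ}

/-- Two level structures with the same basis sections are equal (the remaining fields are
propositions). [folklore] -/
theorem ext_PQ {φ ψ : LevelStructure N C} (hP : φ.P = ψ.P) (hQ : φ.Q = ψ.Q) : φ = ψ := by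
  cases φ
  cases ψ
  cases hP
  cases hQ
  rfl

/-- The restriction of an `N`-torsion section to a fibre is `N`-torsion. [folklore] -/
theorem restrict_pow_eq_one {Ω : Type u} [Field Ω] (s : Spec (.of Ω) ⟶ S) {P : C.Sections}
    (hP : P ^ N = 1) : C.restrict s P ^ N = 1 := by
  change (toUnit (Over.mk s) ≫ P) ^ N = 1
  rw [← MonObj.comp_pow, hP, MonObj.comp_one]

variable (φ ψ : LevelStructure N C) {Ω : Type u} [Field Ω] [IsAlgClosed Ω] (s : Spec (.of Ω) ⟶ S)

/-! ### The transition matrix between two level structures on a geometric fibre -/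

/-- Every `N`-torsion section has coordinates in the basis `φ|_s` on the geometric fibre at `s`
(`basis_surjective`). [folklore] -/
theorem exists_coord {P : C.Sections} (hP : P ^ N = 1) :
    ∃ ab : ZMod N × ZMod N, C.restrict s (φ.section_ ab) = C.restrict s P :=
  φ.basis_surjective s (C.restrict s P) (restrict_pow_eq_one s hP)

/-- The coordinates of `ψ.P|_s` in the basis `φ|_s`. [folklore] -/
def coordP : ZMod N × ZMod N :=
  (φ.exists_coord s ψ.pow_P).choose

/-- Defining property of `coordP`. [folklore] -/
theorem restrict_section_coordP :
    C.restrict s (φ.section_ (φ.coordP ψ s)) = C.restrict s ψ.P :=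
  (φ.exists_coord s ψ.pow_P).choose_spec

/-- The coordinates of `ψ.Q|_s` in the basis `φ|_s`. [folklore] -/
def coordQ : ZMod N × ZMod N :=
  (φ.exists_coord s ψ.pow_Q).choose

/-- Defining property of `coordQ`. [folklore] -/
theorem restrict_section_coordQ :
    C.restrict s (φ.section_ (φ.coordQ ψ s)) = C.restrict s ψ.Q :=
  (φ.exists_coord s ψ.pow_Q).choose_spec

/-- **The transition matrix** `γ ∈ M₂(ℤ/N)` from `φ|_s` to `ψ|_s`: its columns are the coordinates
of `ψ.P|_s` and `ψ.Q|_s` in the basis `φ|_s`, so that `ψ|_s = (φ ∘ γ)|_s`. [folklore] -/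
def transMat : Matrix (Fin 2) (Fin 2) (ZMod N) :=
  !![(φ.coordP ψ s).1, (φ.coordQ ψ s).1; (φ.coordP ψ s).2, (φ.coordQ ψ s).2]

/-- Entry `γ₀₀`. [folklore] -/
@[simp] theorem transMat_apply_zero_zero : φ.transMat ψ s 0 0 = (φ.coordP ψ s).1 := rfl
/-- Entry `γ₀₁`. [folklore] -/
@[simp] theorem transMat_apply_zero_one : φ.transMat ψ s 0 1 = (φ.coordQ ψ s).1 := rfl
/-- Entry `γ₁₀`. [folklore] -/
@[simp] theorem transMat_apply_one_zero : φ.transMat ψ s 1 0 = (φ.coordP ψ s).2 := rfl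
/-- Entry `γ₁₁`. [folklore] -/
@[simp] theorem transMat_apply_one_one : φ.transMat ψ s 1 1 = (φ.coordQ ψ s).2 := rfl

variable [IsCommMonObj C.E] [NeZero N]

/-- **`ψ(x, y)|_s = φ(γ · (x, y)ᵀ)|_s`** for the transition matrix `γ`. [folklore] -/
theorem restrict_section_eq (xy : ZMod N × ZMod N) :
    C.restrict s (ψ.section_ xy) = C.restrict s (φ.section_ (vecAct (φ.transMat ψ s) xy)) := by
  have hP := φ.restrict_section_coordP ψ s
  have hQ := φ.restrict_section_coordQ ψ s
  have h1 : C.restrict s (ψ.section_ xy) = C.restrict s ψ.P ^ xy.1.val * C.restrict s ψ.Q ^ xy.2.val := by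
    change toUnit (Over.mk s) ≫ (ψ.P ^ xy.1.val * ψ.Q ^ xy.2.val) = _
    rw [MonObj.comp_mul, MonObj.comp_pow, MonObj.comp_pow]
  have h2 : C.restrict s (φ.section_ (φ.coordP ψ s)) ^ xy.1.val *
      C.restrict s (φ.section_ (φ.coordQ ψ s)) ^ xy.2.val =
        C.restrict s (φ.section_ (φ.coordP ψ s) ^ xy.1.val * φ.section_ (φ.coordQ ψ s) ^ xy.2.val) := by
    change _ = toUnit (Over.mk s) ≫ _
    rw [MonObj.comp_mul, MonObj.comp_pow, MonObj.comp_pow]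
  rw [h1, ← hP, ← hQ, h2, φ.section_pow_mul_section_pow φ.commute_PQ, vecAct_apply]
  rfl

/-- `(x, y) ↦ γ · (x, y)ᵀ` is injective for the transition matrix (because `ψ|_s` is injective
on `(ℤ/N)²`). [folklore] -/
theorem vecAct_transMat_injective : Function.Injective (vecAct (φ.transMat ψ s)) := by
  intro xy xy' h
  apply ψ.basis_injective s
  change C.restrict s (ψ.section_ xy) = C.restrict s (ψ.section_ xy')
  rw [φ.restrict_section_eq ψ s, φ.restrict_section_eq ψ s, h]

/-- Hence `v ↦ γ v` is surjective on column vectors. [folklore] -/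
theorem mulVec_transMat_surjective : Function.Surjective (φ.transMat ψ s).mulVec := by
  intro w
  obtain ⟨xy, hxy⟩ :=
    Finite.surjective_of_injective (φ.vecAct_transMat_injective ψ s) (w 0, w 1)
  refine ⟨![xy.1, xy.2], ?_⟩
  rw [vecAct_apply, Prod.mk.injEq] at hxy
  ext i
  fin_cases i
  · simp only [Matrix.mulVec, dotProduct, Fin.sum_univ_two, Matrix.cons_val_zero,
      Matrix.cons_val_one, Fin.zero_eta, Fin.isValue]
    exact hxy.1
  · simp only [Matrix.mulVec, dotProduct, Fin.sum_univ_two, Matrix.cons_val_zero,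
      Matrix.cons_val_one, Fin.mk_one, Fin.isValue]
    exact hxy.2

/-- **The transition matrix is invertible.** [folklore] -/
theorem isUnit_transMat : IsUnit (φ.transMat ψ s) :=
  Matrix.mulVec_surjective_iff_isUnit.mp (φ.mulVec_transMat_surjective ψ s)

/-- The transition matrix as an element of `GL₂(ℤ/N) = (M₂(ℤ/N))ˣ`. [folklore] -/
def transGL : (Matrix (Fin 2) (Fin 2) (ZMod N))ˣ :=
  (φ.isUnit_transMat ψ s).unit

/-- The underlying matrix of `transGL`. [folklore] -/
@[simp]
theorem val_transGL : (φ.transGL ψ s : Matrix (Fin 2) (Fin 2) (ZMod N)) = φ.transMat ψ s :=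
  rfl

/-! ### Simple transitivity on geometric fibres -/

/-- **Existence**: `(φ ∘ γ)|_s = ψ|_s` on all of `(ℤ/N)²` for `γ = transGL φ ψ s`. [folklore] -/
theorem restrict_twistGL_transGL (xy : ZMod N × ZMod N) :
    C.restrict s ((φ.twistGL φ.commute_PQ (φ.transGL ψ s)).section_ xy) =
      C.restrict s (ψ.section_ xy) := by
  rw [twistGL_section_, val_transGL, φ.restrict_section_eq ψ s]

/-- **Uniqueness**: a `γ ∈ GL₂(ℤ/N)` with `(φ ∘ γ)|_s = ψ|_s` on `(ℤ/N)²` is the transition matrix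
(compare on `(1, 0)` and `(0, 1)` using `basis_injective` for `φ`). [folklore] -/
theorem transGL_unique (γ : (Matrix (Fin 2) (Fin 2) (ZMod N))ˣ)
    (hγ : ∀ xy : ZMod N × ZMod N,
      C.restrict s ((φ.twistGL φ.commute_PQ γ).section_ xy) = C.restrict s (ψ.section_ xy)) :
    γ = φ.transGL ψ s := by
  have key : ∀ xy : ZMod N × ZMod N,
      vecAct (γ : Matrix (Fin 2) (Fin 2) (ZMod N)) xy = vecAct (φ.transMat ψ s) xy := by
    intro xy
    apply φ.basis_injective s
    change C.restrict s (φ.section_ _) = C.restrict s (φ.section_ _)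
    rw [← twistGL_section_ φ φ.commute_PQ γ, hγ, φ.restrict_section_eq ψ s]
  have h10 := key (1, 0)
  have h01 := key (0, 1)
  simp only [vecAct_apply, mul_one, mul_zero, add_zero, zero_add, Prod.mk.injEq] at h10 h01
  apply Units.ext
  rw [val_transGL]
  ext i j
  fin_cases i <;> fin_cases j
  · exact h10.1
  · exact h01.1
  · exact h10.2
  · exact h01.2

/-- **`GL₂(ℤ/N)` acts simply transitively on level-`N` structures, fibre by fibre**: for level
structures `φ, ψ` on `E/S` and a geometric point `s` of `S` there is a unique `γ ∈ GL₂(ℤ/N)` with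
`(φ ∘ γ)(x, y)|_s = ψ(x, y)|_s` for all `(x, y) ∈ (ℤ/N)²` (Deligne (3.7): `GL₂(ℤ/n)` acts on the
level-`n` problem; both structures are bases of `E[N](s) ≃ (ℤ/N)²`).
[cite: Deligne1971Bourbaki355, (3.7)] -/
theorem existsUnique_twistGL_restrict :
    ∃! γ : (Matrix (Fin 2) (Fin 2) (ZMod N))ˣ, ∀ xy : ZMod N × ZMod N,
      C.restrict s ((φ.twistGL φ.commute_PQ γ).section_ xy) = C.restrict s (ψ.section_ xy) :=
  ⟨φ.transGL ψ s, φ.restrict_twistGL_transGL ψ s, fun γ hγ => φ.transGL_unique ψ s γ hγ⟩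

end EllCurveOver.LevelStructure

/-! ### Over an algebraically closed field: level structures form a `GL₂(ℤ/N)`-torsor -/

namespace EllCurveOver.LevelStructure

variable {Ω : Type u} [Field Ω] {C : EllCurveOver (Spec (.of Ω))}

/-- Over the base `Spec Ω` itself (`s = 𝟙`), restriction to the fibre is the identity on sections.
[folklore] -/
theorem restrict_id (P : C.Sections) : C.restrict (𝟙 (Spec (.of Ω))) P = P := by
  change toUnit (𝟙_ (Over (Spec (.of Ω)))) ≫ P = P
  rw [toUnit_unit, Category.id_comp]

variable [IsAlgClosed Ω] [IsCommMonObj C.E] {N : ℕ} [NeZero N] (φ ψ : LevelStructure N C)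

/-- Over `S = Spec Ω`, `Ω` algebraically closed: `ψ = φ ∘ γ` for the transition matrix at the
point `𝟙 : Spec Ω → Spec Ω`. [folklore] -/
theorem twistGL_transGL_eq : φ.twistGL φ.commute_PQ (φ.transGL ψ (𝟙 _)) = ψ := by
  have hP := φ.restrict_section_coordP ψ (𝟙 _)
  have hQ := φ.restrict_section_coordQ ψ (𝟙 _)
  rw [restrict_id, restrict_id] at hP hQ
  apply ext_PQ
  · rw [twistGL_P, val_transGL, transMat_apply_zero_zero, transMat_apply_one_zero, Prod.mk.eta,
      hP]
  · rw [twistGL_Q, val_transGL, transMat_apply_zero_one, transMat_apply_one_one, Prod.mk.eta,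
      hQ]

/-- **Over an algebraically closed field the full level-`N` structures on `E` form a
`GL₂(ℤ/N)`-torsor**: for any two of them, `ψ = φ ∘ γ` for a unique `γ ∈ GL₂(ℤ/N)` (the geometric
fibres of Deligne's `M_n → M_1`, (3.7)). [cite: Deligne1971Bourbaki355, (3.7)] -/
theorem existsUnique_twistGL_eq :
    ∃! γ : (Matrix (Fin 2) (Fin 2) (ZMod N))ˣ, φ.twistGL φ.commute_PQ γ = ψ := by
  refine ⟨φ.transGL ψ (𝟙 _), φ.twistGL_transGL_eq ψ, fun γ hγ => ?_⟩
  apply φ.transGL_unique ψ (𝟙 _) γ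
  intro xy
  rw [hγ]

end EllCurveOver.LevelStructure

end Literature.NumberTheory.EllipticCurves

end
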